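import Literature.Dynamics.Hamiltonian.ChengXue2023.TrivialSquares

/-!
# The order-theoretic core of the uniqueness and isometry steps of Lemma `LmFundamental` — for PRODUCT domains

CITATION HEADER (lean-in-tree rule 2026-08-18). Source under adjudication: C.-Q. Cheng, J. Xue, *Arnold diffusion
for nearly integrable Hamiltonian systems*, Sci. China Math. **66** (2023) 1649–1712, doi:10.1007/s11425-022-2118-1 (bib
key `ChengXue2023`), read in arXiv:1503.04153v5 (`n-diffusion05082019.tex`, locators `l.NNNN`), Appendix E, proof of
Lemma `LmFundamental` (l.3101–3134).  The two steps concerned, verbatim.  UNIQUENESS (l.3120; the cell's LEMMAS/GAPS name this step ":3118" after the paragraph it answers, which begins at l.3118): "For any B^ℓ_c ∈ 𝔉_c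
there is only one S_δ ∈ 𝔅_{1,ε} such that B^ℓ_c + S_δ ∈ 𝔝₁. Otherwise, there would be S_δ' ≠ S_δ such that
B^ℓ_c + S_δ' ∈ 𝔝₁ also. As we have B^ℓ_c + S'_δ = B^ℓ_c + S_δ + S'_δ − S_δ where B^ℓ_c + S_δ ∈ 𝔝₁ and S'_δ ∼ S_δ,
which contradicts the definition of 𝔖₁."  ISOMETRY (l.3120–3128: sentence l.3120, display (isometric) l.3121–3127, "where q=(q₁,q₂)" l.3128): "d(B_c^ℓ, B_{c'}^ℓ) =
max_{q ∈ 𝕊_{d₁}(q*)} |B_c^ℓ(q,0) − B_{c'}^ℓ(q,0)| ≥ max_{|q₁−q₁*| ≤ d₁} |min_{|q₂−q₂*| ≤ d₁} B_c^ℓ(q,0) − min_{|q₂−q₂*|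
≤ d₁} B_{c'}^ℓ(q,0)| = max_{|q₁−q₁*| ≤ d₁} |S_δ(q) − S'_δ(q)| = d(S_δ, S'_δ)", where 𝔖₁ = the perturbations that are
functions of q₁ alone on the square (l.3103), ∼ = equality up to an additive constant (l.3105), 𝔝₁ = {B : π₁ Argmin(𝕊,
B) = [q₁* − d₁, q₁* + d₁]} (l.3112–3114), Argmin(𝕊, B) = {q ∈ 𝕊 : B(q) = min_𝕊 B} (l.3084).  THESE ARE CLAIMS UNDER
ADJUDICATION by the pub-arnold near-miss cell (LEMMAS §3.X AF6 (E4′), typed residual T-LmF-box; claim rows C43/C44):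
nothing in this file asserts or uses any statement of the paper as a fact, and nothing here concerns Hamiltonian
systems.

WHAT IS PROVED HERE (pure order theory on a product of two arbitrary subsets `J, J' ⊆ ℝ` — nothing about ℝ is used except to match
the `Argmin` of `TrivialSquares.lean`; every declaration kernel-checked, tagged [folklore]).  For a product domain
`R = J ×ˢ J'` (the square of l.3082 and the BOXES of `GridBoxes.lean` alike), functions `B B' : ℝ × ℝ → ℝ` and
perturbations `S S' : ℝ → ℝ` depending on the first coordinate only:
* `fst_image_argmin_prod_eq_iff`: `π₁ Argmin(R, F) = J` iff every first coordinate `x ∈ J` carries a point `(x, y) ∈ R`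
  minimising `F` over `R` (the membership in 𝔝₁, unfolded);
* `argmin_fibre_value_eq`: if `(x, y)` minimises `B + S∘π₁` and `(x, y')` minimises `B + S'∘π₁` over `R` (same `x`), then
  `B (x, y) = B (x, y')` — both are the fibre minimum of `B` over `{x} × J'`;
* `argmin_translate_unique` (l.3120 for product domains): if `π₁ Argmin(R, B + S∘π₁) = J` and `π₁ Argmin(R, B + S'∘π₁)
  = J`, then `S − S'` is CONSTANT on `J` (`S ∼ S'`);
* `argmin_translate_isometry` (the inequality of l.3121–3127 for product domains, in the quotient-by-constants form
  the text uses implicitly): if `π₁ Argmin(R, B + S∘π₁) = J`, `π₁ Argmin(R, B' + S'∘π₁) = J` and `|B − B'| ≤ C` on `R`,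
  then for some constant `κ`, `|(S x − S' x) − κ| ≤ C` for all `x ∈ J` — i.e. `dist_∼(S, S') ≤ d_{C⁰(R)}(B, B')`.
No minimum over a fibre is ever formed (no compactness / continuity needed): the argmin points supplied by the
hypotheses play the role of `min_{q₂} B(q₁, q₂)`.  CONSEQUENCE recorded by the cell (typed, NOT adjudicated; owner
C43): lines l.3120 and l.3121–3127 (cited in the cell's transfer table as ":3118" and ":3120–3126") of the transfer table of T-LmF-box use only the product structure of the domain
and are kernel-checked in that generality; the remaining lines of l.3101–3134 (the spaces 𝔖_i, box dimensions, Lemma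
A5) are untouched by this file.
-/

open Set

namespace Literature.Dynamics.Hamiltonian.ChengXue2023

/-- Membership in 𝔝₁ unfolded: the first projection of `Argmin (J ×ˢ J') F` is all of `J` iff over every `x ∈ J`
there is a point of the product minimising `F` over the product. [folklore] -/
theorem fst_image_argmin_prod_eq_iff {J J' : Set ℝ} {F : ℝ × ℝ → ℝ} :
    Prod.fst '' Argmin (J ×ˢ J') F = J ↔ ∀ x ∈ J, ∃ y ∈ J', ∀ q ∈ J ×ˢ J', F (x, y) ≤ F q := by
  constructor
  · intro h x hx
    rw [← h] at hx
    obtain ⟨⟨x', y⟩, ⟨⟨-, hy⟩, hmin⟩, rfl⟩ := hx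
    exact ⟨y, hy, hmin⟩
  · intro h
    apply Subset.antisymm
    · rintro x ⟨q, ⟨hq, -⟩, rfl⟩
      exact hq.1
    · intro x hx
      obtain ⟨y, hy, hmin⟩ := h x hx
      exact ⟨(x, y), ⟨⟨hx, hy⟩, hmin⟩, rfl⟩

/-- Two minimisers over the product with the SAME first coordinate — one of `B + S∘π₁`, one of `B + S'∘π₁` — have
the same `B`-value (the fibre minimum of `B` over `{x} × J'`). [folklore] -/
theorem argmin_fibre_value_eq {J J' : Set ℝ} {B : ℝ × ℝ → ℝ} {S S' : ℝ → ℝ} {x y y' : ℝ}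
    (hy : (x, y) ∈ Argmin (J ×ˢ J') (fun q => B q + S q.1))
    (hy' : (x, y') ∈ Argmin (J ×ˢ J') (fun q => B q + S' q.1)) : B (x, y) = B (x, y') := by
  have h1 := hy.2 (x, y') hy'.1
  have h2 := hy'.2 (x, y) hy.1
  dsimp only at h1 h2
  linarith

/-- All minimisers of one function over the product have the same value. [folklore] -/
theorem argmin_value_eq {R : Set (ℝ × ℝ)} {F : ℝ × ℝ → ℝ} {q q' : ℝ × ℝ} (hq : q ∈ Argmin R F)
    (hq' : q' ∈ Argmin R F) : F q = F q' :=
  le_antisymm (hq.2 q' hq'.1) (hq'.2 q hq.1)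

/-- **UNIQUENESS MODULO CONSTANTS (l.3118, for product domains).**  If both `B + S∘π₁` and `B + S'∘π₁` have
argmin over `J ×ˢ J'` projecting onto all of `J`, then `S − S'` is constant on `J`. [folklore] -/
theorem argmin_translate_unique {J J' : Set ℝ} {B : ℝ × ℝ → ℝ} {S S' : ℝ → ℝ}
    (hS : Prod.fst '' Argmin (J ×ˢ J') (fun q => B q + S q.1) = J)
    (hS' : Prod.fst '' Argmin (J ×ˢ J') (fun q => B q + S' q.1) = J) :
    ∃ κ : ℝ, ∀ x ∈ J, S x - S' x = κ := by
  rw [fst_image_argmin_prod_eq_iff] at hS hS'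
  rcases J.eq_empty_or_nonempty with hJ | ⟨x₀, hx₀⟩
  · exact ⟨0, by simp [hJ]⟩
  obtain ⟨y₀, hy₀, hmin₀⟩ := hS x₀ hx₀
  obtain ⟨y₀', hy₀', hmin₀'⟩ := hS' x₀ hx₀
  refine ⟨(B (x₀, y₀) + S x₀) - (B (x₀, y₀') + S' x₀), fun x hx => ?_⟩
  obtain ⟨y, hy, hmin⟩ := hS x hx
  obtain ⟨y', hy', hmin'⟩ := hS' x hx
  have hA : (x, y) ∈ Argmin (J ×ˢ J') (fun q => B q + S q.1) := ⟨⟨hx, hy⟩, hmin⟩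
  have hA' : (x, y') ∈ Argmin (J ×ˢ J') (fun q => B q + S' q.1) := ⟨⟨hx, hy'⟩, hmin'⟩
  have hA₀ : (x₀, y₀) ∈ Argmin (J ×ˢ J') (fun q => B q + S q.1) := ⟨⟨hx₀, hy₀⟩, hmin₀⟩
  have hA₀' : (x₀, y₀') ∈ Argmin (J ×ˢ J') (fun q => B q + S' q.1) := ⟨⟨hx₀, hy₀'⟩, hmin₀'⟩
  have e1 := argmin_value_eq hA hA₀      -- B(x,y) + S x = B(x₀,y₀) + S x₀
  have e2 := argmin_value_eq hA' hA₀'    -- B(x,y') + S' x = B(x₀,y₀') + S' x₀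
  have e3 := argmin_fibre_value_eq hA hA' -- B(x,y) = B(x,y')
  dsimp only at e1 e2
  linarith

/-- **THE ISOMETRY INEQUALITY (l.3120–3126, for product domains, quotient-by-constants form).**  If
`B + S∘π₁` and `B' + S'∘π₁` both have argmin over `J ×ˢ J'` projecting onto all of `J`, and `|B − B'| ≤ C` on the
product, then `S − S'` is within `C` of a constant on `J`: the distance of `S, S'` modulo constants is at most the
`C⁰(R)`-distance of `B, B'`. [folklore] -/
theorem argmin_translate_isometry {J J' : Set ℝ} {B B' : ℝ × ℝ → ℝ} {S S' : ℝ → ℝ} {C : ℝ}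
    (hS : Prod.fst '' Argmin (J ×ˢ J') (fun q => B q + S q.1) = J)
    (hS' : Prod.fst '' Argmin (J ×ˢ J') (fun q => B' q + S' q.1) = J)
    (hC : ∀ q ∈ J ×ˢ J', |B q - B' q| ≤ C) :
    ∃ κ : ℝ, ∀ x ∈ J, |(S x - S' x) - κ| ≤ C := by
  rw [fst_image_argmin_prod_eq_iff] at hS hS'
  rcases J.eq_empty_or_nonempty with hJ | ⟨x₀, hx₀⟩
  · exact ⟨0, by simp [hJ]⟩
  obtain ⟨y₀, hy₀, hmin₀⟩ := hS x₀ hx₀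
  obtain ⟨y₀', hy₀', hmin₀'⟩ := hS' x₀ hx₀
  -- κ = μ − μ', the difference of the two minimum values
  refine ⟨(B (x₀, y₀) + S x₀) - (B' (x₀, y₀') + S' x₀), fun x hx => ?_⟩
  obtain ⟨y, hy, hmin⟩ := hS x hx
  obtain ⟨y', hy', hmin'⟩ := hS' x hx
  -- the two minimum values, transported to the fibre over `x`
  have e1 : B (x, y) + S x = B (x₀, y₀) + S x₀ :=
    le_antisymm (hmin (x₀, y₀) ⟨hx₀, hy₀⟩) (hmin₀ (x, y) ⟨hx, hy⟩)
  have e2 : B' (x, y') + S' x = B' (x₀, y₀') + S' x₀ :=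
    le_antisymm (hmin' (x₀, y₀') ⟨hx₀, hy₀'⟩) (hmin₀' (x, y') ⟨hx, hy'⟩)
  -- fibre minima are 1-Lipschitz in the sup norm: compare at the other function's minimiser
  have f1 := hmin (x, y') ⟨hx, hy'⟩   -- B(x,y) + S x ≤ B(x,y') + S x
  have f2 := hmin' (x, y) ⟨hx, hy⟩    -- B'(x,y') + S' x ≤ B'(x,y) + S' x
  have c1 := hC (x, y) ⟨hx, hy⟩
  have c2 := hC (x, y') ⟨hx, hy'⟩
  dsimp only at f1 f2
  rw [abs_le] at c1 c2 ⊢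
  constructor <;> linarith [c1.1, c1.2, c2.1, c2.2]

end Literature.Dynamics.Hamiltonian.ChengXue2023
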